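import Summits.Parity.GeneralizedHardyLittlewood.Theorems.LiouvilleShiftedTablesEngineToPairsSieveTupleBoxed
import Summits.Parity.GeneralizedHardyLittlewood.Theorems.LiouvilleShiftedTablesEngineToPairsSieveTupleTwo

/-!
# Correlation sieve for line `Sketch` of the crux `EngineToPairs` (stmt-Parity-14659), part 8:
# the bound for one split piece, and the registered stub `stub_sieve : CorrelationSieveFamily`

Final file of the stub `stub_sieve`, combining parts 6b and 7c.

* `piece_bound` — for `Large δ x`, `j ∈ {1,2,3}`, `U ≤ 2x^{1/3}`, `x < 2^K`, `1 ≤ K`, and `L ⊆ smoothIdx j`: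
  `∑_q |corrFun (w q) x (∏_i selF V U j L i)| ≤ K^6 · 4 (log x)² (TI + TII + TI2)`:
  `#L ≥ 3` ⇒ the product vanishes on `(x/2, x]` (`V³ > x`); `#L ≤ 1` ⇒ box all factors
  (`corrFun_prod_eq_sum_tuples`, `≤ K^{2j}` tuples) and `tuple_bound_boxed`; `#L = 2` ⇒ box the factors
  other than a high `ζ` factor `t` (over the subtype `{i // i ≠ t}`, `≤ K^{2j−1}` tuples) and
  `tuple_bound_two`.
-/

noncomputable section

namespace Summit.Parity.GeneralizedHardyLittlewood.Theorems.EngineToPairs.Sieve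

open Finset Real
open scoped ArithmeticFunction.zeta ArithmeticFunction.Moebius ArithmeticFunction.sigma
open Literature.NumberTheory.Sieve Literature.NumberTheory.Sieve.BFI

/-- Summing a uniform bound over the family: `∑_q |corrFun (w q) x (∑_{κ∈T} F κ)| ≤ #T · M` when each
`∑_q |corrFun (w q) x (F κ)| ≤ M`. [folklore] -/
theorem sum_abs_corrFun_sum_le {K : Type*} (T : Finset K) (Qs : Finset ℕ) (w : ℕ → ℕ → ℝ) (x : ℝ)
    (F : K → ℕ → ℝ) {M : ℝ} (hM : ∀ κ ∈ T, ∑ q ∈ Qs, |corrFun (w q) x (F κ)| ≤ M) :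
    ∑ q ∈ Qs, |corrFun (w q) x (fun n => ∑ κ ∈ T, F κ n)| ≤ T.card * M := by
  calc ∑ q ∈ Qs, |corrFun (w q) x (fun n => ∑ κ ∈ T, F κ n)|
      = ∑ q ∈ Qs, |∑ κ ∈ T, corrFun (w q) x (F κ)| := by
        refine Finset.sum_congr rfl fun q _ => ?_; rw [corrFun_sum']
    _ ≤ ∑ q ∈ Qs, ∑ κ ∈ T, |corrFun (w q) x (F κ)| := Finset.sum_le_sum fun q _ => Finset.abs_sum_le_sum_abs _ _
    _ = ∑ κ ∈ T, ∑ q ∈ Qs, |corrFun (w q) x (F κ)| := Finset.sum_comm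
    _ ≤ ∑ κ ∈ T, M := Finset.sum_le_sum hM
    _ = T.card * M := by rw [Finset.sum_const, nsmul_eq_mul]

/-- Three high factors make the product vanish on `[1, x]` (`V³ > x`). [this line] -/
theorem prod_selF_eq_zero_of_card {x : ℝ} (hx : 1 < x) {U j : ℕ} (L : Finset (Fin (2 * j)))
    (hLP : L ⊆ smoothIdx j) (hL3 : 3 ≤ L.card) {n : ℕ} (hnx : (n : ℝ) ≤ x) :
    (∏ i, selF (x ^ ((9 : ℝ) / 20)) U j L i) n = 0 := by
  classical
  set V : ℝ := x ^ ((9 : ℝ) / 20) with hV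
  have hV1 : 1 ≤ V := Real.one_le_rpow hx.le (by norm_num)
  by_contra hne
  set a : Fin (2 * j) → ℝ := fun i => if i ∈ L then V else 1 with ha
  have ha0 : ∀ i ∈ (univ : Finset (Fin (2 * j))), 0 ≤ a i := fun i _ => by
    simp only [ha]; split_ifs <;> linarith
  have hf : ∀ i ∈ (univ : Finset (Fin (2 * j))), ∀ d : ℕ, selF V U j L i d ≠ 0 → a i ≤ d := by
    intro i _ d hd
    simp only [ha]
    split_ifs with hiL
    · exact (lt_of_selF_ne_zero_of_mem (hLP hiL) hiL hd).le
    · have : d ≠ 0 := fun h => by rw [h] at hd; exact hd (by simp)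
      exact_mod_cast Nat.pos_of_ne_zero this
  have hlow := prod_apply_ne_zero_lower univ ha0 hf hne
  have hprod : ∏ i, a i = V ^ L.card := by
    rw [ha, Finset.prod_ite_mem, Finset.univ_inter, Finset.prod_const]
  rw [hprod] at hlow
  have hV3 : x < V ^ 3 := by
    have hx0 : (0 : ℝ) ≤ x := le_of_lt (lt_trans zero_lt_one hx)
    have e : V ^ 3 = x ^ ((9 : ℝ) / 20 * ((3 : ℕ) : ℝ)) := by
      rw [hV, Real.rpow_mul hx0, Real.rpow_natCast]
    rw [e]
    calc x = x ^ (1 : ℝ) := (Real.rpow_one x).symm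
      _ < x ^ ((9 : ℝ) / 20 * ((3 : ℕ) : ℝ)) := Real.rpow_lt_rpow_of_exponent_lt hx (by norm_num)
  have hVL : V ^ 3 ≤ V ^ L.card := pow_le_pow_right₀ hV1 hL3
  linarith

/-- **Box-tuple expansion leaving one factor unboxed**: for `0 < x < 2^K` and an index `t`,
`corrFun w x (∏_i f_i) = ∑_{κ : {i // i ≠ t} → {0..K-1}} corrFun w x ((∏_{i ≠ t} boxRestrict (κ i) f_i) ⋆ f_t)`
(the tuple extended by `0` at `t`). [this line] -/
theorem corrFun_prod_eq_sum_tuples_erase {m : ℕ} {x : ℝ} (hx : 0 < x) {K : ℕ} (hK : x < (2 : ℝ) ^ K)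
    (f : Fin m → ArithmeticFunction ℝ) (t : Fin m) (w : ℕ → ℝ) :
    corrFun w x (fun n => (∏ i, f i) n) =
      ∑ κ ∈ Fintype.piFinset (fun _ : {i : Fin m // i ≠ t} => Finset.range K),
        corrFun w x (fun n => ((∏ i ∈ univ.erase t,
          boxRestrict x 1 (if h : i = t then 0 else κ ⟨i, h⟩) (f i)) * f t) n) := by
  classical
  have hK' : x < (1 + (1 : ℝ)) ^ K := by rw [one_add_one_eq_two]; exact hK
  have hsub : ∀ i : Fin m, i ∈ ({t}ᶜ : Finset (Fin m)) ↔ i ≠ t := fun i => by simp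
  have hsub' : ∀ i : Fin m, i ∈ univ.erase t ↔ i ≠ t := fun i => by simp
  have e1 : (∏ i, f i) = f t * ∏ i' : {i : Fin m // i ≠ t}, f i'.val := by
    rw [Fintype.prod_eq_mul_prod_compl t f, Finset.prod_subtype _ hsub f]
  -- locality in the boxed factor
  have hloc : corrFun w x (fun n => (∏ i, f i) n) = corrFun w x (fun n =>
      (f t * ∑ κ ∈ Fintype.piFinset (fun _ : {i : Fin m // i ≠ t} => Finset.range K),
        ∏ i' : {i : Fin m // i ≠ t}, boxRestrict x 1 (κ i') (f i'.val)) n) := by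
    rw [e1]
    unfold corrFun
    refine sum_Ioc_mul_apply_congr_right (f t) _ _ w fun n _ hnx => ?_
    rw [prod_apply_eq_sum_prod_boxRestrict_apply hx one_pos hK' (fun i' : {i : Fin m // i ≠ t} => f i'.val) hnx,
      HeathBrown.finset_sum_apply]
  rw [hloc, Finset.mul_sum, corrFun_finset_sum_apply]
  refine Finset.sum_congr rfl fun κ _ => corrFun_congr fun n _ => ?_
  congr 1
  rw [mul_comm]
  congr 1
  rw [Finset.prod_subtype (univ.erase t) hsub' (fun i => boxRestrict x 1 (if h : i = t then 0 else κ ⟨i, h⟩) (f i))]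
  refine Finset.prod_congr rfl fun i' _ => ?_
  rw [dif_neg i'.prop]

section Piece

variable {δ x : ℝ} (hLx : Large δ x) (hδ : 0 < δ) (hδ' : δ ≤ 1 / 100)
  {Qs : Finset ℕ} {w : ℕ → ℕ → ℝ} {TI TII TI2 : ℝ} (hTI : 0 ≤ TI) (hTII : 0 ≤ TII) (hTI2 : 0 ≤ TI2)
  (hfamI : TypeIFam Qs w x (1 / 2 - 2 * δ) 6 TI) (hfamII : TypeIIFam Qs w x (δ / 2) (1 / 3 + δ / 2) 6 TII)
  (hfamI2 : TypeI2Fam Qs w x δ (3 * δ) 6 TI2)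
  {U j : ℕ} (hj : 1 ≤ j) (hj3 : j ≤ 3) (hU : (U : ℝ) ≤ 2 * x ^ ((1 : ℝ) / 3))
  {K : ℕ} (hK : x < (2 : ℝ) ^ K) (hK1 : 1 ≤ K)

include hLx hδ hδ' hTI hTII hTI2 hfamI hfamII hfamI2 hj hj3 hU hK hK1

set_option maxHeartbeats 1600000 in
/-- **Bound for one split piece** (see the module docstring). [this line] -/
theorem piece_bound (L : Finset (Fin (2 * j))) (hLP : L ⊆ smoothIdx j) :
    ∑ q ∈ Qs, |corrFun (w q) x (fun n => (∏ i, selF (x ^ ((9 : ℝ) / 20)) U j L i) n)| ≤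
      (K : ℝ) ^ 6 * (4 * Real.log x ^ 2 * (TI + TII + TI2)) := by
  classical
  have hx0 : 0 < x := hLx.pos
  have hxlt : 1 < x := hLx.one_lt
  have hlog0 : 0 < Real.log x := hLx.log_pos
  set V : ℝ := x ^ ((9 : ℝ) / 20) with hV
  set M : ℝ := 4 * Real.log x ^ 2 * (TI + TII + TI2) with hM
  have hM0 : 0 ≤ M := by positivity
  have hK0 : (1 : ℝ) ≤ K := by exact_mod_cast hK1
  have hKpow : ∀ m : ℕ, m ≤ 6 → (K : ℝ) ^ m ≤ (K : ℝ) ^ 6 := fun m hm => pow_le_pow_right₀ hK0 hm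
  have hRHS : 0 ≤ (K : ℝ) ^ 6 * M := by positivity
  have hMI : 4 * Real.log x ^ 2 * (TI + TII) ≤ M := by
    rw [hM]; have : 0 ≤ Real.log x ^ 2 := sq_nonneg _; nlinarith
  -- case on `#L`
  rcases le_or_gt 3 L.card with hL3 | hLlt3
  · -- three high factors: everything vanishes
    refine le_of_eq_of_le (Finset.sum_eq_zero fun q _ => ?_) hRHS
    rw [abs_eq_zero]
    refine Finset.sum_eq_zero fun n hn => ?_
    have hnx : (n : ℝ) ≤ x := (natLe_floor_iff hx0.le).1 (Finset.mem_Ioc.1 hn).2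
    dsimp only
    rw [prod_selF_eq_zero_of_card hxlt L hLP hL3 hnx, zero_mul]
  rcases le_or_gt L.card 1 with hL1 | hLgt1
  · -- at most one high factor: box everything
    set T := Fintype.piFinset (fun _ : Fin (2 * j) => Finset.range K) with hT
    have hexp : ∀ q, corrFun (w q) x (fun n => (∏ i, selF V U j L i) n) =
        ∑ κ ∈ T, corrFun (w q) x (fun n => (∏ i, gF x U j L κ i) n) := fun q =>
      corrFun_prod_eq_sum_tuples hx0 hK (fun i => selF V U j L i) (w q)
    have hcard : (T.card : ℝ) ≤ (K : ℝ) ^ 6 := by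
      rw [hT, Fintype.card_piFinset, Finset.prod_const, Finset.card_range, Finset.card_univ, Fintype.card_fin]
      push_cast
      exact hKpow (2 * j) (by omega)
    calc ∑ q ∈ Qs, |corrFun (w q) x (fun n => (∏ i, selF V U j L i) n)|
        = ∑ q ∈ Qs, |∑ κ ∈ T, corrFun (w q) x (fun n => (∏ i, gF x U j L κ i) n)| :=
          Finset.sum_congr rfl fun q _ => by rw [hexp q]
      _ ≤ ∑ q ∈ Qs, ∑ κ ∈ T, |corrFun (w q) x (fun n => (∏ i, gF x U j L κ i) n)| :=
          Finset.sum_le_sum fun q _ => Finset.abs_sum_le_sum_abs _ _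
      _ = ∑ κ ∈ T, ∑ q ∈ Qs, |corrFun (w q) x (fun n => (∏ i, gF x U j L κ i) n)| := Finset.sum_comm
      _ ≤ ∑ κ ∈ T, M := Finset.sum_le_sum fun κ _ =>
          (tuple_bound_boxed hLx hδ hδ' hTI hTII hfamI hfamII hj hj3 hU L hL1 κ).trans hMI
      _ = T.card * M := by rw [Finset.sum_const, nsmul_eq_mul]
      _ ≤ (K : ℝ) ^ 6 * M := mul_le_mul_of_nonneg_right hcard hM0
  · -- exactly two high factors
    have hL2 : L.card = 2 := by omega
    obtain ⟨a, b, hab, hLab⟩ := Finset.card_eq_two.1 hL2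
    obtain ⟨s, t, hst, hsL, htL, ht2⟩ : ∃ s t : Fin (2 * j), s ≠ t ∧ s ∈ L ∧ t ∈ L ∧ t.val ≠ 2 * j - 1 := by
      have haL : a ∈ L := by rw [hLab]; simp
      have hbL : b ∈ L := by rw [hLab]; simp
      by_cases ha : a.val = 2 * j - 1
      · exact ⟨a, b, hab, haL, hbL, fun hb => hab (Fin.ext (by rw [ha, hb]))⟩
      · exact ⟨b, a, hab.symm, hbL, haL, ha⟩
    have hs1 : j ≤ s.val := mem_smoothIdx.1 (hLP hsL)
    have ht1 : j ≤ t.val := mem_smoothIdx.1 (hLP htL)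
    set T := Fintype.piFinset (fun _ : {i : Fin (2 * j) // i ≠ t} => Finset.range K) with hT
    set ext : ({i : Fin (2 * j) // i ≠ t} → ℕ) → Fin (2 * j) → ℕ :=
      fun κ i => if h : i = t then 0 else κ ⟨i, h⟩ with hext
    have hexp : ∀ q, corrFun (w q) x (fun n => (∏ i, selF V U j L i) n) =
        ∑ κ ∈ T, corrFun (w q) x (fun n =>
          ((∏ i ∈ univ.erase t, gF x U j L (ext κ) i) * selF V U j L t) n) := fun q =>
      corrFun_prod_eq_sum_tuples_erase hx0 hK (fun i => selF V U j L i) t (w q)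
    have hcard : (T.card : ℝ) ≤ (K : ℝ) ^ 6 := by
      rw [hT, Fintype.card_piFinset, Finset.prod_const, Finset.card_range, Finset.card_univ]
      push_cast
      refine hKpow _ ((Fintype.card_subtype_le _).trans ?_)
      rw [Fintype.card_fin]; omega
    calc ∑ q ∈ Qs, |corrFun (w q) x (fun n => (∏ i, selF V U j L i) n)|
        = ∑ q ∈ Qs, |∑ κ ∈ T, corrFun (w q) x (fun n =>
            ((∏ i ∈ univ.erase t, gF x U j L (ext κ) i) * selF V U j L t) n)| :=
          Finset.sum_congr rfl fun q _ => by rw [hexp q]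
      _ ≤ ∑ q ∈ Qs, ∑ κ ∈ T, |corrFun (w q) x (fun n =>
            ((∏ i ∈ univ.erase t, gF x U j L (ext κ) i) * selF V U j L t) n)| :=
          Finset.sum_le_sum fun q _ => Finset.abs_sum_le_sum_abs _ _
      _ = ∑ κ ∈ T, ∑ q ∈ Qs, |corrFun (w q) x (fun n =>
            ((∏ i ∈ univ.erase t, gF x U j L (ext κ) i) * selF V U j L t) n)| := Finset.sum_comm
      _ ≤ ∑ κ ∈ T, M := Finset.sum_le_sum fun κ _ =>
          tuple_bound_two hLx hδ hδ' hTI hTII hTI2 hfamI hfamII hfamI2 hj hj3 L hst hsL htL hs1 ht1 ht2 (ext κ)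
      _ = T.card * M := by rw [Finset.sum_const, nsmul_eq_mul]
      _ ≤ (K : ℝ) ^ 6 * M := mul_le_mul_of_nonneg_right hcard hM0

end Piece

end Summit.Parity.GeneralizedHardyLittlewood.Theorems.EngineToPairs.Sieve

/-! ## The registered stub

Assembly with `B = 6`, `C = 1679616`, `x₀ = x₀(δ)` from `exists_large`: Heath-Brown's identity with `K = 3`
through the functional (`corrFun_vonMangoldt_eq`, truncation `U = ⌈x^{1/3}⌉`), the binomial split of each
piece over the subsets `L` of smooth indices at `V = x^{9/20}` (`prod_hbF_eq_sum_powerset`), and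
`piece_bound` for each `(j, L)` with `2^{K'} > x`, `K' = log₂⌊x⌋ + 1 ≤ 3 log x` dyadic boxes per factor:
`∑_q |∑_{x/2<n≤x} Λ(n) w_q(n)| ≤ 3 · 3 · 64 · K'^6 · 4 (log x)² (TI + TII + TI2) ≤ C (log x)^C (TI + TII + TI2)`. -/

namespace Summit.Parity.GeneralizedHardyLittlewood.Theorems.EngineToPairs

open Finset Real
open scoped ArithmeticFunction.vonMangoldt ArithmeticFunction.zeta ArithmeticFunction.Moebius
open Literature.NumberTheory.Sieve Literature.NumberTheory.Sieve.BFI Sieve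

/-- `C(3, j) ≤ 3`. [folklore] -/
theorem choose_three_le (j : ℕ) : (Nat.choose 3 j : ℝ) ≤ 3 := by
  rcases Nat.lt_or_ge j 4 with h | h
  · interval_cases j <;> norm_num [Nat.choose]
  · rw [Nat.choose_eq_zero_of_lt (by omega)]; norm_num

/-- The number of dyadic boxes: with `K' = log₂ ⌊x⌋ + 1`, `x < 2^{K'}` and `K' ≤ 3 log x` (`x ≥ 16`,
`log x ≥ 1`). [folklore] -/
theorem boxes_count {x : ℝ} (hx16 : 16 ≤ x) (hlog1 : 1 ≤ Real.log x) :
    x < (2 : ℝ) ^ (Nat.log 2 ⌊x⌋₊ + 1) ∧ ((Nat.log 2 ⌊x⌋₊ + 1 : ℕ) : ℝ) ≤ 3 * Real.log x := by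
  have hx0 : 0 < x := by linarith
  set N := ⌊x⌋₊ with hN
  have hN16 : 16 ≤ N := Nat.le_floor (by exact_mod_cast hx16)
  have hN0 : N ≠ 0 := by omega
  constructor
  · have h1 : N < 2 ^ (Nat.log 2 N + 1) := Nat.lt_pow_succ_log_self (by norm_num) N
    have h2 : x < (N : ℝ) + 1 := Nat.lt_floor_add_one x
    have h3 : ((N : ℝ) + 1) ≤ (2 : ℝ) ^ (Nat.log 2 N + 1) := by exact_mod_cast h1
    linarith
  · have h1 : 2 ^ Nat.log 2 N ≤ N := Nat.pow_log_le_self 2 hN0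
    have h2 : ((2 : ℝ) ^ Nat.log 2 N) ≤ N := by exact_mod_cast h1
    have hNx : (N : ℝ) ≤ x := Nat.floor_le hx0.le
    have h3 : (Nat.log 2 N : ℝ) * Real.log 2 ≤ Real.log x := by
      rw [← Real.log_pow]
      exact Real.log_le_log (by positivity) (h2.trans hNx)
    have hl2 : (1 : ℝ) / 2 < Real.log 2 := by have := Real.log_two_gt_d9; linarith
    have h4 : (Nat.log 2 N : ℝ) ≤ 2 * Real.log x := by
      have h0 : (0 : ℝ) ≤ Nat.log 2 N := Nat.cast_nonneg _
      nlinarith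
    push_cast
    linarith

/-- The truncation point `U = ⌈x^{1/3}⌉`: `⌊x⌋ ≤ U³` and `U ≤ 2 x^{1/3}` (`x ≥ 1`). [folklore] -/
theorem trunc_point {x : ℝ} (hx : 1 ≤ x) :
    ⌊x⌋₊ ≤ ⌈x ^ ((1 : ℝ) / 3)⌉₊ ^ 3 ∧ ((⌈x ^ ((1 : ℝ) / 3)⌉₊ : ℕ) : ℝ) ≤ 2 * x ^ ((1 : ℝ) / 3) := by
  have hx0 : 0 ≤ x := by linarith
  have hc0 : 0 ≤ x ^ ((1 : ℝ) / 3) := Real.rpow_nonneg hx0 _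
  have hc1 : 1 ≤ x ^ ((1 : ℝ) / 3) := Real.one_le_rpow hx (by norm_num)
  set U := ⌈x ^ ((1 : ℝ) / 3)⌉₊ with hU
  have hUge : x ^ ((1 : ℝ) / 3) ≤ U := Nat.le_ceil _
  constructor
  · have h1 : x ≤ (U : ℝ) ^ 3 := by
      have e : (x ^ ((1 : ℝ) / 3)) ^ 3 = x := by
        rw [← Real.rpow_natCast, ← Real.rpow_mul hx0]; norm_num
      calc x = (x ^ ((1 : ℝ) / 3)) ^ 3 := e.symm
        _ ≤ (U : ℝ) ^ 3 := pow_le_pow_left₀ hc0 hUge 3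
    have h2 : (⌊x⌋₊ : ℝ) ≤ (U : ℝ) ^ 3 := (Nat.floor_le hx0).trans h1
    exact_mod_cast h2
  · have := Nat.ceil_lt_add_one hc0
    rw [← hU] at this
    linarith

set_option maxHeartbeats 1600000 in
/-- **The weight-agnostic correlation sieve, family form** — the registered load-bearing stub of line
`Sketch` for the crux `EngineToPairs` (stmt-Parity-14659): Heath-Brown `K = 3`, dyadic boxes, the
exponent trichotomy, and the generic Type-I / Type-II / Type-I₂ dispatch (parts 1–8a). [this line] -/
theorem stub_sieve : CorrelationSieveFamily := by
  classical
  intro δ hδ hδ'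
  obtain ⟨x₀, hx₀⟩ := exists_large hδ hδ'
  refine ⟨6, 1679616, x₀, fun x hx Qs w _hw TI TII TI2 hTI hTII hTI2 hI hII hI2 => ?_⟩
  have hLx : Large δ x := hx₀ x hx
  have hx1 : 1 ≤ x := hLx.one_lt.le
  have hx0 : 0 < x := hLx.pos
  have hlog1 : 1 ≤ Real.log x := hLx.one_le_log
  have hlog0 : 0 < Real.log x := hLx.log_pos
  set S : ℝ := TI + TII + TI2 with hS
  have hS0 : 0 ≤ S := by positivity
  set M : ℝ := 4 * Real.log x ^ 2 * S with hM
  have hM0 : 0 ≤ M := by positivity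
  -- parameters
  obtain ⟨hU3, hU2⟩ := trunc_point hx1
  set U := ⌈x ^ ((1 : ℝ) / 3)⌉₊ with hU
  obtain ⟨hK, hK3⟩ := boxes_count hLx.sixteen_le hlog1
  set K' := Nat.log 2 ⌊x⌋₊ + 1 with hK'
  have hK1 : 1 ≤ K' := by omega
  set V : ℝ := x ^ ((9 : ℝ) / 20) with hV
  -- the bound for one Heath-Brown piece
  have hpiece : ∀ j ∈ Icc 1 3, ∑ q ∈ Qs, |corrFun (w q) x (fun n => hbPiece U j n)| ≤ 64 * ((K' : ℝ) ^ 6 * M) := by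
    intro j hj
    obtain ⟨hj1, hj3⟩ := Finset.mem_Icc.1 hj
    have hexp : ∀ q, corrFun (w q) x (fun n => hbPiece U j n) =
        ∑ L ∈ (smoothIdx j).powerset, corrFun (w q) x (fun n => (∏ i, selF V U j L i) n) := by
      intro q
      rw [← corrFun_finset_sum_apply]
      refine corrFun_congr fun n _ => ?_
      rw [hbPiece_eq_prod_hbF U hj1, prod_hbF_eq_sum_powerset V U j]
    have hcard : (((smoothIdx j).powerset.card : ℕ) : ℝ) ≤ 64 := by
      rw [Finset.card_powerset]
      have h1 : (smoothIdx j).card ≤ 6 := (Finset.card_le_univ _).trans (by rw [Fintype.card_fin]; omega)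
      have h2 : 2 ^ (smoothIdx j).card ≤ 2 ^ 6 := Nat.pow_le_pow_right (by norm_num) h1
      exact_mod_cast h2
    calc ∑ q ∈ Qs, |corrFun (w q) x (fun n => hbPiece U j n)|
        = ∑ q ∈ Qs, |∑ L ∈ (smoothIdx j).powerset, corrFun (w q) x (fun n => (∏ i, selF V U j L i) n)| :=
          Finset.sum_congr rfl fun q _ => by rw [hexp q]
      _ ≤ ∑ q ∈ Qs, ∑ L ∈ (smoothIdx j).powerset, |corrFun (w q) x (fun n => (∏ i, selF V U j L i) n)| :=
          Finset.sum_le_sum fun q _ => Finset.abs_sum_le_sum_abs _ _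
      _ = ∑ L ∈ (smoothIdx j).powerset, ∑ q ∈ Qs, |corrFun (w q) x (fun n => (∏ i, selF V U j L i) n)| :=
          Finset.sum_comm
      _ ≤ ∑ L ∈ (smoothIdx j).powerset, (K' : ℝ) ^ 6 * M := Finset.sum_le_sum fun L hL =>
          piece_bound hLx hδ hδ' hTI hTII hTI2 hI hII hI2 hj1 hj3 hU2 hK hK1 L (Finset.mem_powerset.1 hL)
      _ = (smoothIdx j).powerset.card * ((K' : ℝ) ^ 6 * M) := by rw [Finset.sum_const, nsmul_eq_mul]
      _ ≤ 64 * ((K' : ℝ) ^ 6 * M) := mul_le_mul_of_nonneg_right hcard (by positivity)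
  -- Heath-Brown's identity through the functional, and the sum over `j`
  have hHB : ∀ q, ∑ n ∈ Ioc ⌊x / 2⌋₊ ⌊x⌋₊, Λ n * w q n =
      ∑ j ∈ Icc 1 3, (-1 : ℝ) ^ (j + 1) * (Nat.choose 3 j : ℝ) * corrFun (w q) x (fun n => hbPiece U j n) :=
    fun q => corrFun_vonMangoldt_eq hU3 (w q)
  have hmain : ∑ q ∈ Qs, |∑ n ∈ Ioc ⌊x / 2⌋₊ ⌊x⌋₊, Λ n * w q n| ≤ 3 * (3 * (64 * ((K' : ℝ) ^ 6 * M))) := by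
    calc ∑ q ∈ Qs, |∑ n ∈ Ioc ⌊x / 2⌋₊ ⌊x⌋₊, Λ n * w q n|
        = ∑ q ∈ Qs, |∑ j ∈ Icc 1 3, (-1 : ℝ) ^ (j + 1) * (Nat.choose 3 j : ℝ) *
            corrFun (w q) x (fun n => hbPiece U j n)| := Finset.sum_congr rfl fun q _ => by rw [hHB q]
      _ ≤ ∑ q ∈ Qs, ∑ j ∈ Icc 1 3, 3 * |corrFun (w q) x (fun n => hbPiece U j n)| := by
          refine Finset.sum_le_sum fun q _ => (Finset.abs_sum_le_sum_abs _ _).trans (Finset.sum_le_sum fun j _ => ?_)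
          rw [abs_mul, abs_mul, abs_pow, abs_neg, abs_one, one_pow, one_mul, Nat.abs_cast]
          exact mul_le_mul_of_nonneg_right (choose_three_le j) (abs_nonneg _)
      _ = ∑ j ∈ Icc 1 3, 3 * ∑ q ∈ Qs, |corrFun (w q) x (fun n => hbPiece U j n)| := by
          rw [Finset.sum_comm]; exact Finset.sum_congr rfl fun j _ => by rw [Finset.mul_sum]
      _ ≤ ∑ j ∈ Icc 1 3, 3 * (64 * ((K' : ℝ) ^ 6 * M)) :=
          Finset.sum_le_sum fun j hj => mul_le_mul_of_nonneg_left (hpiece j hj) (by norm_num)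
      _ = 3 * (3 * (64 * ((K' : ℝ) ^ 6 * M))) := by rw [Finset.sum_const, Nat.card_Icc, nsmul_eq_mul]; norm_num
  -- numerics: `K'^6 ≤ 729 (log x)^6` and `(log x)^8 ≤ (log x)^C`
  have hK6 : (K' : ℝ) ^ 6 ≤ 729 * Real.log x ^ 6 := by
    have h0 : (0 : ℝ) ≤ K' := Nat.cast_nonneg _
    calc (K' : ℝ) ^ 6 ≤ (3 * Real.log x) ^ 6 := pow_le_pow_left₀ h0 hK3 6
      _ = 729 * Real.log x ^ 6 := by ring
  have hlogC : Real.log x ^ 8 ≤ Real.log x ^ (1679616 : ℝ) := by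
    rw [show (1679616 : ℝ) = ((1679616 : ℕ) : ℝ) by norm_num, Real.rpow_natCast]
    exact pow_le_pow_right₀ hlog1 (by norm_num)
  have hfinal : 3 * (3 * (64 * ((K' : ℝ) ^ 6 * M))) ≤ 1679616 * Real.log x ^ (1679616 : ℝ) * (TI + TII + TI2) := by
    have h1 : 3 * (3 * (64 * ((K' : ℝ) ^ 6 * M))) = 576 * (K' : ℝ) ^ 6 * M := by ring
    rw [h1, hM]
    have h2 : 576 * (K' : ℝ) ^ 6 * (4 * Real.log x ^ 2 * S) ≤ 576 * (729 * Real.log x ^ 6) * (4 * Real.log x ^ 2 * S) :=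
      mul_le_mul_of_nonneg_right (mul_le_mul_of_nonneg_left hK6 (by norm_num)) (by positivity)
    have h3 : 576 * (729 * Real.log x ^ 6) * (4 * Real.log x ^ 2 * S) = 1679616 * Real.log x ^ 8 * S := by ring
    have h4 : 1679616 * Real.log x ^ 8 * S ≤ 1679616 * Real.log x ^ (1679616 : ℝ) * S :=
      mul_le_mul_of_nonneg_right (mul_le_mul_of_nonneg_left hlogC (by norm_num)) hS0
    linarith
  exact hmain.trans hfinal

end Summit.Parity.GeneralizedHardyLittlewood.Theorems.EngineToPairs

end
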